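import Mathlib
import Summits.ValiantsHypothesis.ValiantsHypothesis.Theorems.ValuativeGCTHeadFlipRankBoundDefs

/-!
# Point evaluations for the rank certificate of line `four-row-count` (crux `ValuativeGCT.HeadFlip`)

Crux `ValuativeGCT.HeadFlip` (stmt-ValiantsHypothesis-15535), line `four-row-count`, registered
sub-stubs `stub_rbV2`, `stub_rbV4`, `stub_rbCells` of `stub_rankBound`, plus the named evaluation
lemmas used by the neighbouring stubs `stub_rbV1` / `stub_rbV3` (lead's blueprint
`RANKBOUND-BLUEPRINT.md`, §1 and §4; definitions in
`Theorems/ValuativeGCTHeadFlipRankBoundDefs.lean`).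

For the explicit moment-curve pencil `d_k = a_k·y₀ + y₃`, `u_k = a_k²·y₁ + a_k³·y₂` (`a_k = k + 1`):
* `rbU_eval_rbPt`: `u_i(p_{ijk}) = a_i²(a_j + a_k)`;
* `rbPsi_eval_rbPt_eq_zero` / `_ne_zero`: `Ψ(S) = Π_{l ∉ S} (d_l - u_l)` vanishes at `p_{ijk}` as
  soon as one of `i, j, k` is outside `S`, and `Ψ({i,j,k})(p_{ijk}) ≠ 0` for distinct `i, j, k`
  (from the landed `stub_rbPtSpec` and injectivity of `a`);
* `rbQq_expand`: the four monomial coefficients of `q_ab = ℓ_ab u_b + ℓ_ba u_a`;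
* `stub_rbV2`: a quadratic `q ∈ A·B` vanishing at three points `p_{α i j}` (distinct apexes `α`)
  with zero `y₃y₁`-coefficient is zero (a quadratic in `a_α` with three distinct roots);
* `stub_rbV4`: the `2 × 2` system with determinant `a_a² a_b² (a_a - a_b) ≠ 0`;
* the values of `d_l - u_l` and `u_l` at the auxiliary points `z₁ = (a_c a_b, a_c + a_b, -1, 0)`,
  `z₂ = (-(a_c + a_b), -1, 0, a_c a_b)`, `z_c = (1, a_c, -1, -a_c)`;
* `stub_rbCells`: the four cells `d₀ + u₀, d₁ + u₁, u₀, u₁` are linearly independent (the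
  `4 × 4` coefficient matrix is the numeric matrix `[[1,2,0,0],[1,4,1,4],[1,8,1,8],[1,1,0,0]]`,
  with explicit inverse).
[this crux; new]
-/

-- `Summit.ValiantsHypothesis.ValiantsHypothesis.…` is the tree's mandated single-conjunct layout (Sub = Summit).
set_option linter.dupNamespace false

namespace Summit.ValiantsHypothesis.ValiantsHypothesis.Theorems.HeadFlip

open MvPolynomial Finset
open scoped BigOperators

noncomputable section

/-! ### The parameters `a_k = k + 1` -/

/-- `a_k` is the natural number `k + 1` cast to `ℂ`. [this crux] -/
theorem rbA_eq_natCast {n : ℕ} (k : Fin n) : rbA k = (((k : ℕ) + 1 : ℕ) : ℂ) := by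
  simp [rbA]

/-- `a_k ≠ 0`. [this crux] -/
theorem rbA_ne_zero {n : ℕ} (k : Fin n) : rbA k ≠ 0 := by
  rw [rbA_eq_natCast]
  exact Nat.cast_ne_zero.2 (Nat.succ_ne_zero _)

/-- `a_i + a_j ≠ 0` (both are positive integers). [this crux] -/
theorem rbA_add_ne_zero {n : ℕ} (i j : Fin n) : rbA i + rbA j ≠ 0 := by
  rw [rbA_eq_natCast, rbA_eq_natCast, ← Nat.cast_add]
  exact Nat.cast_ne_zero.2 (by omega)

/-- `k ↦ a_k` is injective. [this crux] -/
theorem rbA_injective {n : ℕ} : Function.Injective (rbA : Fin n → ℂ) := by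
  intro k l h
  simp only [rbA, add_left_inj, Nat.cast_inj] at h
  exact Fin.ext h

/-! ### Values at the special points `p_{ijk}` -/

/-- **FACT P2** of the blueprint: `u_i(p_{ijk}) = a_i²(e₁ - a_i) = a_i²(a_j + a_k)`. [this crux] -/
theorem rbU_eval_rbPt : ∀ {n : ℕ} (i j k : Fin n),
    MvPolynomial.eval (rbPt i j k) (rbU i) = rbA i ^ 2 * (rbA j + rbA k) := by
  intro n i j k
  simp only [rbU, rbUv, rbPt, Fin.sum_univ_four, Matrix.cons_val_zero, Matrix.cons_val_one,
    Matrix.head_cons, Matrix.cons_val_two, Matrix.tail_cons, Matrix.cons_val_three]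
  simp only [map_add, MvPolynomial.smul_eval, MvPolynomial.eval_X, Matrix.cons_val_zero,
    Matrix.cons_val_one, Matrix.head_cons, Matrix.cons_val_two, Matrix.tail_cons,
    Matrix.cons_val_three]
  ring

/-- `Ψ(S)(p_{ijk}) = 0` as soon as one of `i, j, k` lies outside `S`: the factor `d_l - u_l`
(`l ∈ {i,j,k} ∖ S`) vanishes at `p_{ijk}` by `stub_rbPtSpec`. [this crux] -/
theorem rbPsi_eval_rbPt_eq_zero : ∀ {n : ℕ} (i j k : Fin n) (S : Finset (Fin n)),
    (i ∉ S ∨ j ∉ S ∨ k ∉ S) → MvPolynomial.eval (rbPt i j k) (rbPsi S) = 0 := by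
  intro n i j k S hS
  rw [rbPsi, map_prod]
  rcases hS with h | h | h
  · exact Finset.prod_eq_zero (Finset.mem_sdiff.2 ⟨Finset.mem_univ _, h⟩) (by simp [stub_rbPtSpec])
  · exact Finset.prod_eq_zero (Finset.mem_sdiff.2 ⟨Finset.mem_univ _, h⟩) (by simp [stub_rbPtSpec])
  · exact Finset.prod_eq_zero (Finset.mem_sdiff.2 ⟨Finset.mem_univ _, h⟩) (by simp [stub_rbPtSpec])

/-- `Ψ({i,j,k})(p_{ijk}) = Π_{l ∉ {i,j,k}} (a_l - a_i)(a_l - a_j)(a_l - a_k) ≠ 0` (the `a_l` are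
pairwise distinct). [this crux] -/
theorem rbPsi_eval_rbPt_ne_zero : ∀ {n : ℕ} (i j k : Fin n), i ≠ j → i ≠ k → j ≠ k →
    MvPolynomial.eval (rbPt i j k) (rbPsi {i, j, k}) ≠ 0 := by
  intro n i j k _ _ _
  rw [rbPsi, map_prod]
  refine Finset.prod_ne_zero_iff.2 fun l hl => ?_
  simp only [Finset.mem_sdiff, Finset.mem_univ, true_and, Finset.mem_insert,
    Finset.mem_singleton, not_or] at hl
  obtain ⟨hli, hlj, hlk⟩ := hl
  rw [stub_rbPtSpec]
  exact mul_ne_zero (mul_ne_zero (sub_ne_zero.2 (rbA_injective.ne hli))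
    (sub_ne_zero.2 (rbA_injective.ne hlj))) (sub_ne_zero.2 (rbA_injective.ne hlk))

/-- The four monomial coefficients of `q_ab = ℓ_ab·u_b + ℓ_ba·u_a` on `y₃y₁, y₃y₂, y₀y₁, y₀y₂`.
[this crux] -/
theorem rbQq_expand : ∀ {n : ℕ} (c : Fin 3 × (Fin n × Fin n) → ℂ) (a b : Fin n),
    rbQq c a b =
      (c (1, (a, b)) * rbA b ^ 2 + c (1, (b, a)) * rbA a ^ 2) • (X 3 * X 1 : MvPolynomial (Fin 4) ℂ) +
      (c (1, (a, b)) * rbA b ^ 3 + c (1, (b, a)) * rbA a ^ 3) • (X 3 * X 2 : MvPolynomial (Fin 4) ℂ) +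
      (c (0, (a, b)) * rbA b ^ 2 + c (0, (b, a)) * rbA a ^ 2) • (X 0 * X 1 : MvPolynomial (Fin 4) ℂ) +
      (c (0, (a, b)) * rbA b ^ 3 + c (0, (b, a)) * rbA a ^ 3) • (X 0 * X 2 : MvPolynomial (Fin 4) ℂ) := by
  intro n c a b
  simp only [rbQq, rbEll, rbU, rbUv, Fin.sum_univ_four, Matrix.cons_val_zero, Matrix.cons_val_one,
    Matrix.head_cons, Matrix.cons_val_two, Matrix.tail_cons, Matrix.cons_val_three,
    MvPolynomial.smul_eq_C_mul, map_add, map_mul, map_pow, map_zero]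
  ring

/-- Three distinct roots kill a quadratic: if `A x² + B x + C` vanishes at three pairwise distinct
points of `ℂ` then `A = B = C = 0` (Vandermonde by hand). [folklore] -/
theorem quad_coeff_eq_zero_of_three_roots {A B C x y z : ℂ} (hxy : x ≠ y) (hxz : x ≠ z)
    (hyz : y ≠ z) (hx : A * x ^ 2 + B * x + C = 0) (hy : A * y ^ 2 + B * y + C = 0)
    (hz : A * z ^ 2 + B * z + C = 0) : A = 0 ∧ B = 0 ∧ C = 0 := by
  have h1 : A * (x + y) + B = 0 := by
    have h : (x - y) * (A * (x + y) + B) = 0 := by linear_combination hx - hy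
    exact (mul_eq_zero.1 h).resolve_left (sub_ne_zero.2 hxy)
  have h2 : A * (x + z) + B = 0 := by
    have h : (x - z) * (A * (x + z) + B) = 0 := by linear_combination hx - hz
    exact (mul_eq_zero.1 h).resolve_left (sub_ne_zero.2 hxz)
  have hA : A = 0 := by
    have h : (y - z) * A = 0 := by linear_combination h1 - h2
    exact (mul_eq_zero.1 h).resolve_left (sub_ne_zero.2 hyz)
  have hB : B = 0 := by linear_combination h1 - (x + y) * hA
  have hC : C = 0 := by linear_combination hx - x ^ 2 * hA - x * hB
  exact ⟨hA, hB, hC⟩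

/-- **stub_rbV2** (registered sub-goal of `stub_rankBound`, line four-row-count of crux HeadFlip;
LEMMA V2 of the blueprint, "three apexes pin a pair"): a quadratic
`q = c₀₀ y₃y₁ + c₀₁ y₃y₂ + c₁₀ y₀y₁ + c₁₁ y₀y₂ ∈ A·B` vanishing at the three points `p_{α_r i j}`
(`α` injective) and with `c₀₀ = 0` is zero.  With `s = a_i + a_j`, `p = a_i a_j`, `α = a_{α_r}`,
`q(p_{α i j}) = α²(-p c₀₀ + s c₁₀) + α(-s p c₀₀ + p c₀₁ + (s² + p) c₁₀ - s c₁₁) + (s p c₁₀ - p c₁₁)`,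
a quadratic in `α` with three distinct roots; its coefficients vanish, and `s, p ≠ 0`. [this crux] -/
theorem stub_rbV2 : ∀ {n : ℕ} (i j : Fin n) (α : Fin 3 → Fin n), i ≠ j → Function.Injective α →
    (∀ r, α r ≠ i ∧ α r ≠ j) → ∀ (c₀₀ c₀₁ c₁₀ c₁₁ : ℂ),
    (∀ r, MvPolynomial.eval (rbPt (α r) i j)
      (c₀₀ • (X 3 * X 1 : MvPolynomial (Fin 4) ℂ) + c₀₁ • (X 3 * X 2 : MvPolynomial (Fin 4) ℂ) +
        c₁₀ • (X 0 * X 1 : MvPolynomial (Fin 4) ℂ) + c₁₁ • (X 0 * X 2 : MvPolynomial (Fin 4) ℂ)) = 0) →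
    c₀₀ = 0 → c₀₁ = 0 ∧ c₁₀ = 0 ∧ c₁₁ = 0 := by
  intro n i j α _ hα _ c₀₀ c₀₁ c₁₀ c₁₁ hev h00
  subst h00
  -- the evaluated quadratic, as a quadratic in `a_{α r}`
  have hq : ∀ r : Fin 3,
      ((rbA i + rbA j) * c₁₀) * rbA (α r) ^ 2 +
        ((rbA i * rbA j) * c₀₁ + ((rbA i + rbA j) ^ 2 + rbA i * rbA j) * c₁₀ - (rbA i + rbA j) * c₁₁) *
          rbA (α r) +
        ((rbA i + rbA j) * (rbA i * rbA j) * c₁₀ - (rbA i * rbA j) * c₁₁) = 0 := by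
    intro r
    have h := hev r
    simp only [map_add, MvPolynomial.smul_eval, map_mul, MvPolynomial.eval_X, rbPt,
      Matrix.cons_val_zero, Matrix.cons_val_one, Matrix.head_cons, Matrix.cons_val_two,
      Matrix.tail_cons, Matrix.cons_val_three] at h
    linear_combination h
  have h01 : rbA (α 0) ≠ rbA (α 1) := rbA_injective.ne (hα.ne (by decide))
  have h02 : rbA (α 0) ≠ rbA (α 2) := rbA_injective.ne (hα.ne (by decide))
  have h12 : rbA (α 1) ≠ rbA (α 2) := rbA_injective.ne (hα.ne (by decide))
  obtain ⟨hA, hB, hC⟩ := quad_coeff_eq_zero_of_three_roots h01 h02 h12 (hq 0) (hq 1) (hq 2)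
  have hs : rbA i + rbA j ≠ 0 := rbA_add_ne_zero i j
  have hp : rbA i * rbA j ≠ 0 := mul_ne_zero (rbA_ne_zero i) (rbA_ne_zero j)
  have h10 : c₁₀ = 0 := (mul_eq_zero.1 hA).resolve_left hs
  have h11 : c₁₁ = 0 := by
    have h : (rbA i * rbA j) * c₁₁ = 0 := by
      linear_combination (rbA i + rbA j) * (rbA i * rbA j) * h10 - hC
    exact (mul_eq_zero.1 h).resolve_left hp
  have h01' : c₀₁ = 0 := by
    have h : (rbA i * rbA j) * c₀₁ = 0 := by
      linear_combination hB - ((rbA i + rbA j) ^ 2 + rbA i * rbA j) * h10 + (rbA i + rbA j) * h11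
    exact (mul_eq_zero.1 h).resolve_left hp
  exact ⟨h01', h10, h11⟩

/-- **stub_rbV4** (registered sub-goal of `stub_rankBound`, line four-row-count of crux HeadFlip;
the `2 × 2` systems of LEMMA V4 of the blueprint): `x a_b² + x' a_a² = 0 = x a_b³ + x' a_a³` with
`a ≠ b` forces `x = x' = 0` (determinant `a_a² a_b² (a_a - a_b) ≠ 0`). [this crux] -/
theorem stub_rbV4 : ∀ {n : ℕ} (a b : Fin n), a ≠ b → ∀ (x x' : ℂ),
    x * rbA b ^ 2 + x' * rbA a ^ 2 = 0 → x * rbA b ^ 3 + x' * rbA a ^ 3 = 0 → x = 0 ∧ x' = 0 := by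
  intro n a b hab x x' h1 h2
  have hne : rbA a - rbA b ≠ 0 := sub_ne_zero.2 (rbA_injective.ne hab)
  have hx : x * (rbA b ^ 2 * (rbA a - rbA b)) = 0 := by linear_combination rbA a * h1 - h2
  have hx0 : x = 0 :=
    (mul_eq_zero.1 hx).resolve_right (mul_ne_zero (pow_ne_zero _ (rbA_ne_zero b)) hne)
  refine ⟨hx0, ?_⟩
  have hx' : x' * rbA a ^ 2 = 0 := by linear_combination h1 - rbA b ^ 2 * hx0
  exact (mul_eq_zero.1 hx').resolve_right (pow_ne_zero _ (rbA_ne_zero a))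

/-! ### Values at the auxiliary points `z₁`, `z₂`, `z_c` (LEMMA V3 of the blueprint) -/

/-- At `z₁ = (a_c a_b, a_c + a_b, -1, 0)`: `(d_l - u_l)(z₁) = (a_l - a_c)(a_l - a_b) a_l`. [this crux] -/
theorem rbDU_eval_z1 : ∀ {n : ℕ} (c b l : Fin n),
    MvPolynomial.eval (![rbA c * rbA b, rbA c + rbA b, -1, 0] : Fin 4 → ℂ) (rbD l - rbU l) =
      (rbA l - rbA c) * (rbA l - rbA b) * rbA l := by
  intro n c b l
  simp only [rbD, rbU, rbDv, rbUv, map_sub, Fin.sum_univ_four, Matrix.cons_val_zero,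
    Matrix.cons_val_one, Matrix.head_cons, Matrix.cons_val_two, Matrix.tail_cons,
    Matrix.cons_val_three]
  simp only [map_add, MvPolynomial.smul_eval, MvPolynomial.eval_X, Matrix.cons_val_zero,
    Matrix.cons_val_one, Matrix.head_cons, Matrix.cons_val_two, Matrix.tail_cons,
    Matrix.cons_val_three]
  ring

/-- At `z₂ = (-(a_c + a_b), -1, 0, a_c a_b)`: `(d_l - u_l)(z₂) = (a_l - a_c)(a_l - a_b)`. [this crux] -/
theorem rbDU_eval_z2 : ∀ {n : ℕ} (c b l : Fin n),
    MvPolynomial.eval (![-(rbA c + rbA b), -1, 0, rbA c * rbA b] : Fin 4 → ℂ) (rbD l - rbU l) =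
      (rbA l - rbA c) * (rbA l - rbA b) := by
  intro n c b l
  simp only [rbD, rbU, rbDv, rbUv, map_sub, Fin.sum_univ_four, Matrix.cons_val_zero,
    Matrix.cons_val_one, Matrix.head_cons, Matrix.cons_val_two, Matrix.tail_cons,
    Matrix.cons_val_three]
  simp only [map_add, MvPolynomial.smul_eval, MvPolynomial.eval_X, Matrix.cons_val_zero,
    Matrix.cons_val_one, Matrix.head_cons, Matrix.cons_val_two, Matrix.tail_cons,
    Matrix.cons_val_three]
  ring

/-- At `z₁ = (a_c a_b, a_c + a_b, -1, 0)`: `u_l(z₁) = a_l²(a_c + a_b - a_l)`. [this crux] -/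
theorem rbU_eval_z1 : ∀ {n : ℕ} (c b l : Fin n),
    MvPolynomial.eval (![rbA c * rbA b, rbA c + rbA b, -1, 0] : Fin 4 → ℂ) (rbU l) =
      rbA l ^ 2 * (rbA c + rbA b - rbA l) := by
  intro n c b l
  simp only [rbU, rbUv, Fin.sum_univ_four, Matrix.cons_val_zero, Matrix.cons_val_one,
    Matrix.head_cons, Matrix.cons_val_two, Matrix.tail_cons, Matrix.cons_val_three]
  simp only [map_add, MvPolynomial.smul_eval, MvPolynomial.eval_X, Matrix.cons_val_zero,
    Matrix.cons_val_one, Matrix.head_cons, Matrix.cons_val_two, Matrix.tail_cons,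
    Matrix.cons_val_three]
  ring

/-- At `z₂ = (-(a_c + a_b), -1, 0, a_c a_b)`: `u_l(z₂) = -a_l²`. [this crux] -/
theorem rbU_eval_z2 : ∀ {n : ℕ} (c b l : Fin n),
    MvPolynomial.eval (![-(rbA c + rbA b), -1, 0, rbA c * rbA b] : Fin 4 → ℂ) (rbU l) = -(rbA l ^ 2) := by
  intro n c b l
  simp only [rbU, rbUv, Fin.sum_univ_four, Matrix.cons_val_zero, Matrix.cons_val_one,
    Matrix.head_cons, Matrix.cons_val_two, Matrix.tail_cons, Matrix.cons_val_three]
  simp only [map_add, MvPolynomial.smul_eval, MvPolynomial.eval_X, Matrix.cons_val_zero,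
    Matrix.cons_val_one, Matrix.head_cons, Matrix.cons_val_two, Matrix.tail_cons,
    Matrix.cons_val_three]
  ring

/-- At `z_c = (1, a_c, -1, -a_c)`: `(d_l - u_l)(z_c) = (a_l - a_c)(a_l² + 1)`. [this crux] -/
theorem rbDU_eval_zc : ∀ {n : ℕ} (c l : Fin n),
    MvPolynomial.eval (![1, rbA c, -1, -rbA c] : Fin 4 → ℂ) (rbD l - rbU l) = (rbA l - rbA c) * (rbA l ^ 2 + 1) := by
  intro n c l
  simp only [rbD, rbU, rbDv, rbUv, map_sub, Fin.sum_univ_four, Matrix.cons_val_zero,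
    Matrix.cons_val_one, Matrix.head_cons, Matrix.cons_val_two, Matrix.tail_cons,
    Matrix.cons_val_three]
  simp only [map_add, MvPolynomial.smul_eval, MvPolynomial.eval_X, Matrix.cons_val_zero,
    Matrix.cons_val_one, Matrix.head_cons, Matrix.cons_val_two, Matrix.tail_cons,
    Matrix.cons_val_three]
  ring

/-! ### The four cells -/

/-- `a` of the first index `Fin.castLE h 0` is `1`. [this crux] -/
theorem rbA_castLE_zero {n : ℕ} (h : 2 ≤ n) : rbA (Fin.castLE h 0) = 1 := by
  simp [rbA]

/-- `a` of the second index `Fin.castLE h 1` is `2`. [this crux] -/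
theorem rbA_castLE_one {n : ℕ} (h : 2 ≤ n) : rbA (Fin.castLE h 1) = 2 := by
  simp [rbA]
  norm_num

/-- The coefficient matrix of the four cells `d₀ + u₀, d₁ + u₁, u₀, u₁` (columns) on `y₀, …, y₃`
(rows) is the numeric matrix `[[1,2,0,0],[1,4,1,4],[1,8,1,8],[1,1,0,0]]`. [this crux] -/
theorem rbCells_matrix_eq {n : ℕ} (h : 2 ≤ n) :
    (Matrix.of fun t t' : Fin 4 =>
      (if (Fin.castLE h (![0, 1, 0, 1] t') : Fin n) = Fin.castLE h (![0, 1, 1, 0] t')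
        then rbDv (Fin.castLE h (![0, 1, 0, 1] t')) t else 0) + rbUv (Fin.castLE h (![0, 1, 0, 1] t')) t) =
    !![(1 : ℂ), 2, 0, 0; 1, 4, 1, 4; 1, 8, 1, 8; 1, 1, 0, 0] := by
  ext t t'
  fin_cases t <;> fin_cases t' <;>
    simp [rbDv, rbUv, rbA_castLE_zero, rbA_castLE_one] <;> norm_num

/-- **stub_rbCells** (registered sub-goal of `stub_rankBound`, line four-row-count of crux HeadFlip;
§6 of the blueprint): the four cells `d₀ + u₀, d₁ + u₁, u₀, u₁` of the explicit pencil are linearly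
independent — their coefficient matrix is `[[1,2,0,0],[1,4,1,4],[1,8,1,8],[1,1,0,0]]`, with the
explicit inverse `[[-1,0,0,2],[1,0,0,-1],[1,2,-1,-2],[-1,-1/4,1/4,1]]`. [this crux] -/
theorem stub_rbCells : ∀ {n : ℕ} (h : 2 ≤ n),
    IsUnit (Matrix.of fun t t' : Fin 4 =>
      (if (Fin.castLE h (![0, 1, 0, 1] t') : Fin n) = Fin.castLE h (![0, 1, 1, 0] t')
        then rbDv (Fin.castLE h (![0, 1, 0, 1] t')) t else 0) + rbUv (Fin.castLE h (![0, 1, 0, 1] t')) t) := by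
  intro n h
  rw [rbCells_matrix_eq h]
  refine IsUnit.of_mul_eq_one
    (!![(-1 : ℂ), 0, 0, 2; 1, 0, 0, -1; 1, 2, -1, -2; -1, -1/4, 1/4, 1] : Matrix (Fin 4) (Fin 4) ℂ) ?_
  ext i j
  fin_cases i <;> fin_cases j <;> simp [Matrix.mul_apply, Fin.sum_univ_four] <;> norm_num

end

end Summit.ValiantsHypothesis.ValiantsHypothesis.Theorems.HeadFlip
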